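import Summits.ResolutionOfSingularities.ResolutionOfSingularities.Theorems.EquisingularLiftEquisingularLiftNatLargeCharFibreStrictTransform
import Summits.ResolutionOfSingularities.ResolutionOfSingularities.Theorems.EquisingularLiftEquisingularLiftNatStrictTransformExceptionalCartier
import HarnessLib

/-!
# EL♮(3) / EL♮(n), RUNG LC «large characteristic» — brick LC-FIB (f1), fibre side WITHOUT the exact-multiple form: the strict transform commutes
# with passage to the fibre as soon as its trace on the exceptional divisor is flat over the base

leafhand-res-equisingularlift-3 g0 (prover, 2026-08-31; one-generation line-first hand on stmt-ResolutionOfSingularities-20148 / -20038 /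
-15660, cell `pub/decomp-res`).  Crux `EquisingularLiftNatThree` (`stmt-…-20148`; uniform in `n`, so also `stmt-…-20038`), line W4.5(b), RUNG LC
(idea-2 g32 `Cruxes/EquisingularLiftNatThree/LARGE-CHAR-RUNG-idea2.md` v1.6 §(B3′)/(B3″) (f1) LC-FIB).  Sequel of ✓ `…NatLargeCharFibreStrictTransform`
(★ `comap_strictTransformIdeal_of_flat_traces`, which asked for the exact-multiple form `π^*𝓣 = Eᵐ·𝓣'` of LC-ST and the flatness of `E`): here the
strict transform `𝓣' := strictTransformIdeal π C 𝓣 = ⋃ₙ (π^*𝓣 : Eⁿ)` is used for what it is — the SMALLEST `E`-saturated ideal above `π^*𝓣` — so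
that NO order / exact-multiple bookkeeping is needed on the B-side, and the ONLY spreading input left for (f1) is the flatness over the base of the
trace `E ∩ V(𝓣')` (generic flatness after a shrink).  DEF-FREE:

* `strictTransformIdeal_le_of_colon_eq` — **minimality**: every `E`-saturated ideal `𝔰 ⊇ π^*K` contains `strictTransformIdeal π C K`
  (✓ `colon_mono_left`, ✓ `colon_pow_eq_self_of_colon_eq`; replaces the prime-stalk hypothesis of ✓ `strictTransformIdeal_le_of_prime_stalks`);
* (tree inputs) the strict transform is `E`-saturated, so **`E ∩ V(𝓣')` is ALWAYS an effective Cartier divisor in `V(𝓣')`** — ✓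
  `Summit.…Cruxes.EquisingularLiftNat.Sections.isEffectiveCartier_comap_subschemeι_strictTransformIdeal` (…NatStrictTransformExceptionalCartier, TOWER₃ S7
  (viii); Literature twin ✓ `isEffectiveCartier_comap_subschemeι_strictTransformIdeal` for blow-ups) — no B-side input (t1) is needed;
* ★ `comap_strictTransformIdeal_of_flat_trace` — **LC-FIB (one blow-up, fibre side), final form**: for a blow-up `π : Z → Y` along `C` of a
  `B`-scheme (`E = π^*C` effective Cartier), a fibre square `s ≫ π = π_k ≫ t` over `Spec k → Spec B` with `Z_k = Z ×_B Spec k` cartesian, `Z`, `Z_k`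
  locally Noetherian, and ANY ideal `𝓣` on `Y`: IF the trace `E ∩ V(𝓣')` is FLAT over `Spec B`, THEN
  `s^*(strictTransformIdeal π C 𝓣) = strictTransformIdeal π_k (t^*C) (t^*𝓣)`.  Proof: `≤` is free (✓ `comap_strictTransformIdeal_le`); `≥` by minimality,
  since `s^*𝓣'` contains `π_k^* t^*𝓣` and is `E_k`-saturated — its `E_k`-trace is Cartier by (t3) ✓ `IsEffectiveCartier.comap_fst_of_flat_subschemeι` on
  `V(𝓣')` (✓ `isEffectiveCartier_comap_comap_subschemeι_of_flat`) and ✓ `colon_eq_self_of_isEffectiveCartier_comap_subschemeι`;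
  `support_comap_strictTransformIdeal_of_flat_trace` — the set form (the ✓ `DescTransformOK` running set `closure (π_k⁻¹ (Y ∖ C_k))`).

WHAT REMAINS of `hspread` after this file (honest, exact): (i) flatness of the traces `E_i ∩ V(𝓣_{i+1})` over `D(a)` along the model tower — scheme-level
generic flatness ✓ `Literature.AlgebraicGeometry.Morphisms.exists_flat_morphismRestrict_basicOpen` + the restriction/base-change plumbing into the
`∀ B ∋ a⁻¹` form of ✓ `CentreSeq.exists_forall_descCentresSmoothOver_comap` (M); (ii) the ideal inclusion `𝓣ᵢ ≤ Cᵢ` over `D(a)` (K-side: set-level E1 +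
regular centre ⇒ `𝓣_K ≤ 𝓘(supp C_K) = C_K`; spread ✓ `exists_comap_ι_le_comap_ι_of_generic`) (S–M); (iii) END smoothness of `V(𝓣_r)` over `D(a)`
(✓ `exists_forall_mem_smoothLocus_of_smooth_comap`, S); (iv) the position token (f3) by fibre dimension (M); (v) the (B5) recursion assembling (i)–(iv)
with ✓ (f2)/(f4)/(f1) into `DescTransformOK` at every `θ` over `D(a)`, then ✓ `descDoorAt_of_smoothCentres` + ✓ `descDoorAt_of_ringHom` + lh2's N:=1
glue ⇒ `DescDoorSharp` ⇒ `hspread` (M).  EL♮(3) NOT proved; EL♮ NOT proved; resolution of singularities in positive characteristic NOT proved; nothing of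
[Hironaka2017] (a candidate under adjudication) is asserted or used.  [OURS · bookkeeping over tree lemmas · standard axioms · DEF-FREE ·
`--supports stmt-ResolutionOfSingularities-20148 --as helper`, counted 0 · AI-written, weaker than expert review.]
[cite: GortzWedhorn2020, (13.19)] [cite: StacksProject, Tag 056P (1), Tag 080E] (method; index only)
-/

noncomputable section

open CategoryTheory CategoryTheory.Limits AlgebraicGeometry TopologicalSpace
open AlgebraicGeometry.Scheme.IdealSheafData

namespace Literature.AlgebraicGeometry.Resolution

universe u

/-! ## Minimality of the strict transform among saturated ideals -/

section Minimal

variable {Y' Z' : Scheme.{u}} {π' : Z' ⟶ Y'}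

/-- **The strict transform is the smallest `E`-saturated ideal above the total transform**: if `π'^*K' ⊆ 𝔰` and `(𝔰 : π'^*C') = 𝔰` then
`strictTransformIdeal π' C' K' = ⋃ₙ (π'^*K' : (π'^*C')ⁿ) ⊆ 𝔰` (each term is `⊆ (𝔰 : (π'^*C')ⁿ) = 𝔰`, ✓ `colon_mono_left`, ✓ `colon_pow_eq_self_of_colon_eq`).
[cite: GortzWedhorn2020, (13.19)] [folklore] -/
theorem strictTransformIdeal_le_of_colon_eq (C' K' : Y'.IdealSheafData) (𝔰 : Z'.IdealSheafData) (hle : K'.comap π' ≤ 𝔰)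
    (hsat : colon 𝔰 (C'.comap π') = 𝔰) : strictTransformIdeal π' C' K' ≤ 𝔰 := by
  refine iSup_le fun n => ?_
  calc colon (K'.comap π') ((C'.comap π') ^ n) ≤ colon 𝔰 ((C'.comap π') ^ n) := colon_mono_left hle _
    _ = 𝔰 := colon_pow_eq_self_of_colon_eq hsat n

end Minimal

/-! ## LC-FIB, one blow-up, fibre side — final form -/

section OneStep

variable {B : Type u} (k : Type u) [CommRing B] [CommRing k] [Algebra B k]
  {Y Yk Z Zk : Scheme.{u}} [IsLocallyNoetherian Z] [IsLocallyNoetherian Zk]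
  (t : Yk ⟶ Y) {π : Z ⟶ Y} {πk : Zk ⟶ Yk} {s : Zk ⟶ Z} (hsq : s ≫ π = πk ≫ t)
  (qZ : Z ⟶ Spec (.of B)) {qZk : Zk ⟶ Spec (.of k)} (HZ : IsPullback s qZk qZ (specOfAlgebra B k))

include hsq HZ in
/-- ★ **LC-FIB (one blow-up, fibre side), final form: the strict transform commutes with passage to the fibre as soon as its trace on the
exceptional divisor is flat over the base.**  Data: a commutative square `s ≫ π = π_k ≫ t` over `Spec k → Spec B` with cartesian top
`Z_k = Z ×_{Spec B} Spec k` (`HZ`), `Z`, `Z_k` locally Noetherian, `E = π^*C` an effective Cartier divisor on `Z` (so for every blow-up `π` along `C`),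
ANY ideal `𝓣` on `Y` with strict transform `𝓣'`, and `E ∩ V(𝓣') → Spec B` FLAT.  Then `s^*𝓣' = strictTransformIdeal π_k (t^*C) (t^*𝓣)`.
`≤`: ✓ `comap_strictTransformIdeal_le` (free).  `≥`: `s^*𝓣' ⊇ s^*π^*𝓣 = π_k^* t^*𝓣` and `s^*𝓣'` is `E_k`-saturated — its trace is Cartier
(✓ `…Sections.isEffectiveCartier_comap_subschemeι_strictTransformIdeal` on the B-side, (t3) ✓ `isEffectiveCartier_comap_comap_subschemeι_of_flat`, then
✓ `colon_eq_self_of_isEffectiveCartier_comap_subschemeι`) — so minimality `strictTransformIdeal_le_of_colon_eq` applies.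
[cite: GortzWedhorn2020, (13.19)] [cite: StacksProject, Tag 056P (1)] [OURS · L1 W4.5b · RUNG LC (B3′)(f1) fibre side; EL♮(3) NOT proved] -/
theorem comap_strictTransformIdeal_of_flat_trace (C T : Y.IdealSheafData) (hE : IsEffectiveCartier (C.comap π))
    [Flat ((((C.comap π).comap (strictTransformIdeal π C T).subschemeι)).subschemeι ≫ (strictTransformIdeal π C T).subschemeι ≫ qZ)] :
    (strictTransformIdeal π C T).comap s = strictTransformIdeal πk (C.comap t) (T.comap t) := by
  refine le_antisymm (comap_strictTransformIdeal_le t hsq C T) ?_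
  have hEk : (C.comap t).comap πk = (C.comap π).comap s := by
    rw [← comap_comp, ← comap_comp, hsq]
  refine strictTransformIdeal_le_of_colon_eq _ _ _ ?_ ?_
  · -- `π_k^* t^*𝓣 = s^* π^*𝓣 ⊆ s^*𝓣'`
    rw [← comap_comp, ← hsq, comap_comp]
    exact comap_mono _ (comap_le_strictTransformIdeal π C T)
  · -- `s^*𝓣'` is `E_k`-saturated: its trace is a relative effective Cartier divisor restricted to a fibre
    rw [hEk]
    exact colon_eq_self_of_isEffectiveCartier_comap_subschemeι _ _
      (isEffectiveCartier_comap_comap_subschemeι_of_flat k qZ HZ (strictTransformIdeal π C T) (C.comap π)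
        (Summit.ResolutionOfSingularities.ResolutionOfSingularities.Cruxes.EquisingularLiftNat.Sections.isEffectiveCartier_comap_subschemeι_strictTransformIdeal
          π C T hE))

include hsq HZ in
/-- **… at the level of the k-side running sets**: under the same hypotheses `supp (s^*𝓣') = closure (π_k⁻¹ (supp t^*𝓣 ∖ supp t^*C))`, the running set of
✓ `DescTransformOK` (✓ `support_strictTransformIdeal_eq_closure`). [cite: GortzWedhorn2020, (13.19)] [OURS · L1 W4.5b · RUNG LC (B3′)(f1); EL♮(3) NOT proved] -/
theorem support_comap_strictTransformIdeal_of_flat_trace (C T : Y.IdealSheafData) (hE : IsEffectiveCartier (C.comap π))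
    [Flat ((((C.comap π).comap (strictTransformIdeal π C T).subschemeι)).subschemeι ≫ (strictTransformIdeal π C T).subschemeι ≫ qZ)] :
    ((((strictTransformIdeal π C T).comap s)).support : Set Zk) =
      closure (πk ⁻¹' ((((T.comap t).support : Set Yk)) \ ((C.comap t).support : Set Yk))) := by
  rw [comap_strictTransformIdeal_of_flat_trace k t hsq qZ HZ C T hE]
  exact support_strictTransformIdeal_eq_closure πk (C.comap t) (T.comap t)

end OneStep

end Literature.AlgebraicGeometry.Resolution

end
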